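import Summits.KontsevichZagierPeriods.KontsevichZagierPeriods.Theses.AbelContraction
import Summits.KontsevichZagierPeriods.KontsevichZagierPeriods.Theorems.AbelContractionAreasToArcs
import Summits.KontsevichZagierPeriods.KontsevichZagierPeriods.Theorems.AbelContractionDimensionOneGlue
import Literature.NumberTheory.Transcendental.KZCalculusProofs
import Literature.NumberTheory.Transcendental.KZLogCalculusProofs
import Literature.NumberTheory.Transcendental.KZKernelConjectureForms
import Literature.NumberTheory.Transcendental.SemialgebraicMapsProofs

/-!
# KontsevichZagierPeriods / AbelContraction — the strength of the crux `RealArcKernel`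
# (item stmt-KontsevichZagierPeriods-12472; support file, lands `--supports`)

The crux `RealArcKernel` of route AbelContraction (the kernel conjecture of the KZ calculus ENLARGED
by the one-curve real hyperelliptic sector) is pinned between the route's other items, sorry-free:

* `reductionToDimensionOne_of_realArcKernel` : `RealArcKernel → ReductionToDimensionOne`
  (stmt-12472 ⇒ stmt-14403). So NO line of any shape closes the crux before the GPC-strength item
  `ReductionToDimensionOne` (stmt-14403) is closed; the registered line `Lines/birth.lean`
  (`ReductionToDimensionOne → PlanarAreas → RealArcKernel`, landed glue `dimensionOneGlue_proof`)
  loses nothing but `PlanarAreas`.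
* `realArcKernel_iff_reductionToDimensionOne` : under `PlanarAreas` (stmt-4990) the crux and
  stmt-14403 are EQUIVALENT; `realArcKernel_iff_kzKernelConjecture` : under `PlanarAreas` the crux
  is the kernel form of the summit; `realArcKernel_of_kzKernelConjecture`,
  `realArcKernel_of_kontsevichZagierPeriods` : the summit implies the crux outright.

## The one new calculus lemma

`RealArcKernel → ReductionToDimensionOne` needs the sector hypothesis of the crux discharged from
the dimension-one hypothesis of the reduction, i.e. a NORMAL FORM INSIDE DIMENSION ONE: every
`ℤ`-combination of one- and zero-dimensional representations is `≡ [r] − [r′]` modulo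
`KZ.relations` with `r r′ : KZ.IntegralRep 1` (`exists_sub_of_mem_closure_dimLEOne`). The tree's
merge `KZ.IntegralRep.exists_of_add_of_sub_of_mem_relations` raises the dimension (slabs at two
levels of a new coordinate), which is useless here; instead two representations of the SAME
dimension are merged without moving anything (`exists_sameDim_of_add_sub_of_mem_relations`):
extend both integrands by zero to the union of the domains (rule (1a): `[σ, f] ≡ [σ ∪ σ′, 𝟙_σ f]`,
`exists_extend_sub_mem_relations`) and add the integrands on the common domain (rule (1b)).
Zero-dimensional representations are lifted to dimension one by one slab
(`KZ.IntegralRep.exists_equivalent_of_le`).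

Sources: M. Kontsevich, D. Zagier, *Periods* (2001), §1.2 (rules (1)–(3), Conjecture 1);
A. Huber, S. Müller-Stach, *Periods and Nori Motives* (2017), Conj. 13.2.1 (kernel form).
Deliberately NOT here: any attack on `ReductionToDimensionOne` or `PlanarAreas` themselves.
-/

noncomputable section

open MeasureTheory Set
open Literature.NumberTheory.Transcendental
open Literature.ModelTheory.ExponentialFields (IsSemialgebraic)

namespace Summit.KontsevichZagierPeriods.AbelContraction.RealArcKernelStrength

variable {n : ℕ}

/-! ## Merging two representations of the same dimension (rules (1a), (1b) only) -/

/-- **Extension by zero** (rule (1a)). A representation `r = (σ, f)` of dimension `n` and a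
`ℚ`-semialgebraic `τ ⊇ σ` give the representation `R = (τ, 𝟙_σ f)` of the SAME dimension with
`[r] − [R] ∈ KZ.relations`: `τ = σ ∪ (τ ∖ σ)` is a disjoint decomposition, `R|_σ` has the integrand
of `r` on `σ` and `R|_{τ ∖ σ}` has integrand `0`. [cite: KontsevichZagier2001, §1.2 rule (1)] -/
theorem exists_extend_sub_mem_relations (r : KZ.IntegralRep n) {τ : Set (Fin n → ℝ)}
    (hτ : IsSemialgebraic ℚ τ) (hστ : r.domain ⊆ τ) :
    ∃ R : KZ.IntegralRep n, R.domain = τ ∧ R.integrand = r.domain.indicator r.integrand ∧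
      KZ.of r - KZ.of R ∈ KZ.relations := by
  classical
  have hσ : IsSemialgebraic ℚ r.domain := r.isSemialgebraic_domain
  have hdiff : IsSemialgebraic ℚ (τ \ r.domain) := hτ.diff hσ
  -- the extended integrand is semialgebraic on `τ = σ ∪ (τ \ σ)` (gluing of graphs) and integrable
  have hF : IsSemialgebraicFunOn ℚ τ (r.domain.indicator r.integrand) := by
    have h := r.isSemialgebraicFunOn_integrand.union (isSemialgebraicFunOn_natCast hdiff 0)
      (F := r.domain.indicator r.integrand)
      (fun x hx => by simp [indicator_of_mem hx])
      (fun x hx => by simp [indicator_of_notMem hx.2])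
    rwa [union_sdiff_cancel hστ] at h
  have hint : IntegrableOn (r.domain.indicator r.integrand) τ :=
    (r.integrableOn.integrable_indicator (KZ.IntegralRep.measurableSet_domain_holds r)).integrableOn
  let R : KZ.IntegralRep n :=
    { domain := τ
      integrand := r.domain.indicator r.integrand
      isSemialgebraic_domain := hτ
      isSemialgebraicFunOn_integrand := hF
      integrableOn := hint }
  refine ⟨R, rfl, rfl, ?_⟩
  -- rule (1a): `[R] − [R|σ] − [R|τ∖σ]`
  let R₁ : KZ.IntegralRep n := R.restrict r.domain hσ hστ
  let R₂ : KZ.IntegralRep n := R.restrict (τ \ r.domain) hdiff sdiff_subset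
  have h1 : KZ.of R - KZ.of R₁ - KZ.of R₂ ∈ KZ.domainAddRel := by
    refine ⟨n, R, R₁, R₂, ?_, ?_, fun _ _ => rfl, fun _ _ => rfl, rfl⟩
    · show τ = r.domain ∪ (τ \ r.domain)
      exact (union_sdiff_cancel hστ).symm
    · show volume (r.domain ∩ (τ \ r.domain)) = 0
      rw [inter_sdiff_self]
      exact measure_empty
  -- `[R|σ] − [r]`: same domain, integrands agree on it
  have h2 : KZ.of R₁ - KZ.of r ∈ KZ.relations :=
    KZ.of_sub_of_mem_relations_of_eqOn rfl fun x hx => by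
      show r.domain.indicator r.integrand x = r.integrand x
      exact indicator_of_mem hx _
  -- `[R|τ∖σ]`: integrand `0` on its domain
  have h3 : KZ.of R₂ ∈ KZ.relations :=
    KZ.of_mem_relations_of_eqOn_zero R₂ fun x hx => by
      show r.domain.indicator r.integrand x = 0
      exact indicator_of_notMem hx.2 _
  have : KZ.of r - KZ.of R =
      -(KZ.of R - KZ.of R₁ - KZ.of R₂) - (KZ.of R₁ - KZ.of r) - KZ.of R₂ := by
    abel
  rw [this]
  exact KZ.relations.sub_mem (KZ.relations.sub_mem
    (KZ.relations.neg_mem (KZ.domainAddRel_subset_relations h1)) h2) h3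

/-- **Merging in a fixed dimension** (rules (1a), (1b)). For two representations `r₁ = (σ₁, f₁)`,
`r₂ = (σ₂, f₂)` of the SAME dimension `n` there is one representation `M` of dimension `n` with
`[r₁] + [r₂] − [M] ∈ KZ.relations`, namely `M = (σ₁ ∪ σ₂, 𝟙_{σ₁} f₁ + 𝟙_{σ₂} f₂)`: extend both by
zero to `σ₁ ∪ σ₂` and add the integrands. (The tree's `exists_of_add_of_sub_of_mem_relations`
raises the dimension instead.) [cite: KontsevichZagier2001, §1.2 rule (1)] -/
theorem exists_sameDim_of_add_sub_of_mem_relations (r₁ r₂ : KZ.IntegralRep n) :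
    ∃ M : KZ.IntegralRep n, KZ.of r₁ + KZ.of r₂ - KZ.of M ∈ KZ.relations := by
  have hτ : IsSemialgebraic ℚ (r₁.domain ∪ r₂.domain) :=
    r₁.isSemialgebraic_domain.union r₂.isSemialgebraic_domain
  obtain ⟨R₁, hd₁, -, h₁⟩ := exists_extend_sub_mem_relations r₁ hτ subset_union_left
  obtain ⟨R₂, hd₂, -, h₂⟩ := exists_extend_sub_mem_relations r₂ hτ subset_union_right
  have hs₁ : IsSemialgebraicFunOn ℚ (r₁.domain ∪ r₂.domain) R₁.integrand :=
    hd₁ ▸ R₁.isSemialgebraicFunOn_integrand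
  have hs₂ : IsSemialgebraicFunOn ℚ (r₁.domain ∪ r₂.domain) R₂.integrand :=
    hd₂ ▸ R₂.isSemialgebraicFunOn_integrand
  have hi₁ : IntegrableOn R₁.integrand (r₁.domain ∪ r₂.domain) := hd₁ ▸ R₁.integrableOn
  have hi₂ : IntegrableOn R₂.integrand (r₁.domain ∪ r₂.domain) := hd₂ ▸ R₂.integrableOn
  let M : KZ.IntegralRep n :=
    { domain := r₁.domain ∪ r₂.domain
      integrand := R₁.integrand + R₂.integrand
      isSemialgebraic_domain := hτ
      isSemialgebraicFunOn_integrand := IsSemialgebraicFunOn.add_holds hs₁ hs₂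
      integrableOn := hi₁.add hi₂ }
  refine ⟨M, ?_⟩
  have h3 : KZ.of M - KZ.of R₁ - KZ.of R₂ ∈ KZ.integrandAddRel :=
    ⟨n, M, R₁, R₂, hd₁, hd₂, fun _ _ => rfl, rfl⟩
  have : KZ.of r₁ + KZ.of r₂ - KZ.of M =
      (KZ.of r₁ - KZ.of R₁) + (KZ.of r₂ - KZ.of R₂) - (KZ.of M - KZ.of R₁ - KZ.of R₂) := by
    abel
  rw [this]
  exact KZ.relations.sub_mem (KZ.relations.add_mem h₁ h₂) (KZ.integrandAddRel_subset_relations h3)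

/-! ## Normal form inside dimension one -/

/-- **Normal form inside dimension one.** Every element of the subgroup of `KZ.FormalRep` generated
by the one-dimensional and the zero-dimensional representations is, modulo `KZ.relations`, a
difference `[r] − [r′]` of two ONE-dimensional representations: generators `[r] ≡ [r] − [∅]`,
constants are lifted to dimension one by a slab (`KZ.IntegralRep.exists_equivalent_of_le`), sums
are merged inside dimension one (`exists_sameDim_of_add_sub_of_mem_relations`), and `−([r] − [r′]) =
[r′] − [r]`. [cite: KontsevichZagier2001, §1.2] -/
theorem exists_sub_of_mem_closure_dimLEOne {x : KZ.FormalRep}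
    (hx : x ∈ AddSubgroup.closure
      ({x : KZ.FormalRep | ∃ r : KZ.IntegralRep 1, x = KZ.of r} ∪
        {x : KZ.FormalRep | ∃ c : KZ.IntegralRep 0, x = KZ.of c})) :
    ∃ r r' : KZ.IntegralRep 1, x - (KZ.of r - KZ.of r') ∈ KZ.relations := by
  induction hx using AddSubgroup.closure_induction with
  | mem y hy =>
    rcases hy with ⟨r, rfl⟩ | ⟨c, rfl⟩
    · refine ⟨r, KZ.IntegralRep.empty 1, ?_⟩
      have : KZ.of r - (KZ.of r - KZ.of (KZ.IntegralRep.empty 1)) =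
          KZ.of (KZ.IntegralRep.empty 1) := by
        abel
      rw [this]
      exact KZ.IntegralRep.of_empty_mem_relations
    · obtain ⟨s, hs⟩ := KZ.IntegralRep.exists_equivalent_of_le c (Nat.zero_le 1)
      refine ⟨s, KZ.IntegralRep.empty 1, ?_⟩
      have : KZ.of c - (KZ.of s - KZ.of (KZ.IntegralRep.empty 1)) =
          (KZ.of c - KZ.of s) + KZ.of (KZ.IntegralRep.empty 1) := by
        abel
      rw [this]
      exact KZ.relations.add_mem hs KZ.IntegralRep.of_empty_mem_relations
  | zero =>
    exact ⟨KZ.IntegralRep.empty 1, KZ.IntegralRep.empty 1, by simp⟩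
  | add y z _ _ hy hz =>
    obtain ⟨r₁, r₁', h₁⟩ := hy
    obtain ⟨r₂, r₂', h₂⟩ := hz
    obtain ⟨M, hM⟩ := exists_sameDim_of_add_sub_of_mem_relations r₁ r₂
    obtain ⟨M', hM'⟩ := exists_sameDim_of_add_sub_of_mem_relations r₁' r₂'
    refine ⟨M, M', ?_⟩
    have : y + z - (KZ.of M - KZ.of M') =
        (y - (KZ.of r₁ - KZ.of r₁')) + (z - (KZ.of r₂ - KZ.of r₂')) +
          (KZ.of r₁ + KZ.of r₂ - KZ.of M) - (KZ.of r₁' + KZ.of r₂' - KZ.of M') := by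
      abel
    rw [this]
    exact KZ.relations.sub_mem (KZ.relations.add_mem (KZ.relations.add_mem h₁ h₂) hM) hM'
  | neg y _ hy =>
    obtain ⟨r, r', h⟩ := hy
    refine ⟨r', r, ?_⟩
    have : -y - (KZ.of r' - KZ.of r) = -(y - (KZ.of r - KZ.of r')) := by abel
    rw [this]
    exact KZ.relations.neg_mem h

/-- **The sector lies inside dimension `≤ 1`.** The generating set of the one-curve real
hyperelliptic sector of the polynomial `q` (representations `[σ, (A + B√q)/D]` and the constants)
is contained in the set of all one- and zero-dimensional generators. [cite: KontsevichZagier2001, §1.2] -/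
theorem sector_subset_dimLEOne (q : Polynomial ℚ) :
    ({x : KZ.FormalRep | ∃ (r : KZ.IntegralRep 1) (A B D : Polynomial ℚ),
        (∀ p ∈ r.domain, 0 < Polynomial.aeval (p 0) q ∧ Polynomial.aeval (p 0) D ≠ 0) ∧
        Set.EqOn r.integrand (fun p => (Polynomial.aeval (p 0) A +
          Polynomial.aeval (p 0) B * Real.sqrt (Polynomial.aeval (p 0) q)) /
          Polynomial.aeval (p 0) D) r.domain ∧ x = KZ.of r} ∪
      {x : KZ.FormalRep | ∃ c : KZ.IntegralRep 0, x = KZ.of c}) ⊆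
    ({x : KZ.FormalRep | ∃ r : KZ.IntegralRep 1, x = KZ.of r} ∪
      {x : KZ.FormalRep | ∃ c : KZ.IntegralRep 0, x = KZ.of c}) := by
  refine union_subset_union_left _ ?_
  rintro _ ⟨r, A, B, D, -, -, rfl⟩
  exact ⟨r, rfl⟩

/-! ## The strength of the crux -/

/-- **`RealArcKernel → ReductionToDimensionOne`** (stmt-12472 ⇒ stmt-14403). Given
`R ≥ KZ.relations` containing `[r] − [r′]` for every equal-valued one-dimensional pair, the sector
hypothesis of the crux holds for `R`: a value-`0` element `y` of the sector subgroup is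
`≡ [r] − [r′]` modulo relations with `r r′` one-dimensional (`exists_sub_of_mem_closure_dimLEOne`),
soundness of the moves gives `r.value = r′.value`, so `[r] − [r′] ∈ R` and `y ∈ R`; the crux then
puts `ker KZ.eval` inside `R`. Consequently no proof of the crux avoids proving stmt-14403.
[cite: KontsevichZagier2001, §1.2 Conjecture 1] -/
theorem reductionToDimensionOne_of_realArcKernel : Summit.KontsevichZagierPeriods.KontsevichZagierPeriods.Theses.AbelContraction.RealArcKernel → Summit.KontsevichZagierPeriods.KontsevichZagierPeriods.Theses.AbelContraction.ReductionToDimensionOne := by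
  unfold Summit.KontsevichZagierPeriods.KontsevichZagierPeriods.Theses.AbelContraction.ReductionToDimensionOne
  intro h R hR h1 x hx
  refine h R hR ?_ x hx
  intro q y hy hy0
  obtain ⟨r, r', hrel⟩ :=
    exists_sub_of_mem_closure_dimLEOne (AddSubgroup.closure_mono (sector_subset_dimLEOne q) hy)
  have hker : KZ.eval (y - (KZ.of r - KZ.of r')) = 0 := KZ.relations_le_ker_eval_holds hrel
  rw [map_sub, hy0, zero_sub, neg_eq_zero, KZ.eval_of_sub_of, sub_eq_zero] at hker
  have h2 : KZ.of r - KZ.of r' ∈ R := h1 r r' hker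
  have : y = (y - (KZ.of r - KZ.of r')) + (KZ.of r - KZ.of r') := by abel
  rw [this]
  exact R.add_mem (hR hrel) h2

/-- **Under the 1-period layer the crux IS the reduction**: `PlanarAreas → (RealArcKernel ↔
ReductionToDimensionOne)`; the backward direction is the landed glue `dimensionOneGlue_proof`
(stmt-14404) fed with the landed transfer `areasToArcs_proof` (stmt-0117).
[cite: KontsevichZagier2001, §1.2 Conjecture 1] -/
theorem realArcKernel_iff_reductionToDimensionOne
    (hP : Summit.KontsevichZagierPeriods.KontsevichZagierPeriods.Theses.AbelContraction.PlanarAreas) :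
    Summit.KontsevichZagierPeriods.KontsevichZagierPeriods.Theses.AbelContraction.RealArcKernel ↔
      Summit.KontsevichZagierPeriods.KontsevichZagierPeriods.Theses.AbelContraction.ReductionToDimensionOne :=
  ⟨reductionToDimensionOne_of_realArcKernel, fun hRed =>
    Summit.KontsevichZagierPeriods.AbelContraction.dimensionOneGlue_proof hP
      Summit.KontsevichZagierPeriods.AbelContraction.AreasToArcs.areasToArcs_proof hRed⟩

/-- **The kernel form of the summit implies the crux** (monotonicity in `R`: `ker eval = relations ≤
R`; the sector hypothesis is not used). [cite: KontsevichZagier2001, §1.2 Conjecture 1] -/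
theorem realArcKernel_of_kzKernelConjecture (h : KZKernelConjecture) :
    Summit.KontsevichZagierPeriods.KontsevichZagierPeriods.Theses.AbelContraction.RealArcKernel := by
  unfold Summit.KontsevichZagierPeriods.KontsevichZagierPeriods.Theses.AbelContraction.RealArcKernel
  intro R hR _ x hx
  exact hR (h x hx)

/-- **The summit implies the crux**: `KontsevichZagierPeriods → RealArcKernel`, through the proved
equivalence of the summit with the kernel form (`kzKernelConjecture_iff_isRational`).
[cite: KontsevichZagier2001, §1.2 Conjecture 1] -/
theorem realArcKernel_of_kontsevichZagierPeriods (h : KontsevichZagierPeriods) :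
    Summit.KontsevichZagierPeriods.KontsevichZagierPeriods.Theses.AbelContraction.RealArcKernel :=
  realArcKernel_of_kzKernelConjecture (kzKernelConjecture_iff_isRational.mpr h)

/-- **The reduction and the 1-period layer give the kernel form**: `PlanarAreas →
ReductionToDimensionOne → KZKernelConjecture` (take `R := KZ.relations`; the dimension-one pairs
are relations by `areasToArcs_proof`). [cite: KontsevichZagier2001, §1.2 Conjecture 1] -/
theorem kzKernelConjecture_of_reductionToDimensionOne
    (hP : Summit.KontsevichZagierPeriods.KontsevichZagierPeriods.Theses.AbelContraction.PlanarAreas)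
    (hRed : Summit.KontsevichZagierPeriods.KontsevichZagierPeriods.Theses.AbelContraction.ReductionToDimensionOne) :
    KZKernelConjecture := fun x hx =>
  hRed KZ.relations le_rfl
    (fun r r' hv => Summit.KontsevichZagierPeriods.AbelContraction.AreasToArcs.areasToArcs_proof hP r r' hv)
    x hx

/-- **Under the 1-period layer the crux IS the kernel form of the summit**: `PlanarAreas →
(RealArcKernel ↔ KZKernelConjecture)`. [cite: KontsevichZagier2001, §1.2 Conjecture 1] -/
theorem realArcKernel_iff_kzKernelConjecture
    (hP : Summit.KontsevichZagierPeriods.KontsevichZagierPeriods.Theses.AbelContraction.PlanarAreas) :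
    Summit.KontsevichZagierPeriods.KontsevichZagierPeriods.Theses.AbelContraction.RealArcKernel ↔
      KZKernelConjecture :=
  ⟨fun h => kzKernelConjecture_of_reductionToDimensionOne hP
    (reductionToDimensionOne_of_realArcKernel h), realArcKernel_of_kzKernelConjecture⟩

/-- **Under the 1-period layer the crux IS the summit**: `PlanarAreas → (RealArcKernel ↔
KontsevichZagierPeriods)` (`kzKernelConjecture_iff_isRational`).
[cite: KontsevichZagier2001, §1.2 Conjecture 1] -/
theorem realArcKernel_iff_kontsevichZagierPeriods
    (hP : Summit.KontsevichZagierPeriods.KontsevichZagierPeriods.Theses.AbelContraction.PlanarAreas) :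
    Summit.KontsevichZagierPeriods.KontsevichZagierPeriods.Theses.AbelContraction.RealArcKernel ↔
      KontsevichZagierPeriods :=
  (realArcKernel_iff_kzKernelConjecture hP).trans kzKernelConjecture_iff_isRational

end Summit.KontsevichZagierPeriods.AbelContraction.RealArcKernelStrength

end
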